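import Mathlib
import HarnessLib
import Summits.QuantumFields.YangMills.Theorems.ComplexCouplingChannelContinuumLegGivenGapAlternatingArraysDefs
import Summits.QuantumFields.YangMills.Theorems.ComplexCouplingChannelContinuumLegGivenGapProductToUniformDefs

/-!
# `ContinuumLegGivenGap` (stmt-QuantumFields-15828), line `alternating-curvature-arrays`: `stub_ptuGeometry`, helper G1 — plateau values, near / outer criteria, numerics of the Whitney levels, index-set facts

Support file for the registered piece `stub_ptuGeometry` (geometry of the Whitney system of
`Theorems/ComplexCouplingChannelContinuumLegGivenGapProductToUniformDefs.lean`).  Elementary facts about the landed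
definitions, no analysis:

* §1 the plateau bump is non-zero only STRICTLY inside `(lo, hi)`; the cut-offs and the weights `ptuNear`, `ptuOut`,
  `ptuPhiStar` take values in `[0, 1]`; the NEAR criterion (`ptuNear y ≠ 0 ⇒` some pair is sup-closer than `R a`) and
  its converse direction (`ptuNear = 1` when some pair is within `3Ra/4`); the OUTER criterion (`ptuOut y ≠ 0 ⇒` some
  `|yᵢμ| > aL/8`) and its converse direction (`ptuOut = 1` when some `|yᵢμ| ≥ aL/4`);
* §2 numerics: `64(2p+1) < 3^{m₀}`, `d(m,p) ≥ 32` for `m ≥ m₀`, `(2p+1) d ≤ cellSide m`, the Whitney levels are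
  admissible for triadic `L`;
* §3 the index set `ptuIdx`: unpacking, injectivity of the cell assignment, the inner cut-off is supported in the
  core, the outer cut-off is `1` on the support of the inner one, and on the support of `φ̃` some pair is
  `≤ 240 ℓ`-close and every point lies in its cell box (registered anchor `ptuGeom_index_facts`).

Pure arithmetic over the Defs. [folklore]
-/

set_option autoImplicit false

noncomputable section

open scoped Classical

namespace Summit.QuantumFields.YangMills.Theorems.ContinuumLegGivenGap

open scoped BigOperators
open Summit.QuantumFields.YangMills.Theorems.ContinuumLegGivenGap.AlternatingArrays

/-! ## §1 Plateau values, near and outer criteria -/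

/-- Where the plateau bump (ramp `w > 0`) is non-zero, `t` lies STRICTLY between `lo` and `hi`. [folklore] -/
theorem ptuPlateau_ne_zero_lt {lo hi w t : ℝ} (hw : 0 < w) (h : ptuPlateau lo hi w t ≠ 0) : lo < t ∧ t < hi := by
  constructor
  · by_contra hc
    exact h (ptuPlateau_eq_zero hw (Or.inl (not_lt.1 hc)))
  · by_contra hc
    exact h (ptuPlateau_eq_zero hw (Or.inr (not_lt.1 hc)))

/-- The one-point cut-offs take values in `[0, 1]`. [folklore] -/
theorem ptuCut_mem (a : ℝ) (m : ℕ) (v z : Fin 4 → ℤ) (e w : ℝ) (u : EuclideanSpace ℝ (Fin 4)) :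
    0 ≤ ptuCut a m v z e w u ∧ ptuCut a m v z e w u ≤ 1 := by
  unfold ptuCut
  exact ⟨Finset.prod_nonneg fun μ _ => (ptuPlateau_mem _ _ _ _).1,
    Finset.prod_le_one (fun μ _ => (ptuPlateau_mem _ _ _ _).1) fun μ _ => (ptuPlateau_mem _ _ _ _).2⟩

/-- The tensor bump `φ*` takes values in `[0, 1]`. [folklore] -/
theorem ptuPhiStar_mem (a : ℝ) (m p : ℕ) (v : Fin 4 → ℤ) (z : Fin p → Fin 4 → ℤ)
    (y : Fin p → EuclideanSpace ℝ (Fin 4)) : 0 ≤ ptuPhiStar a m p v z y ∧ ptuPhiStar a m p v z y ≤ 1 := by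
  unfold ptuPhiStar ptuChiFun
  exact ⟨Finset.prod_nonneg fun i _ => (ptuCut_mem _ _ _ _ _ _ _).1,
    Finset.prod_le_one (fun i _ => (ptuCut_mem _ _ _ _ _ _ _).1) fun i _ => (ptuCut_mem _ _ _ _ _ _ _).2⟩

/-- The enlarged tensor bump `φ̃` takes values in `[0, 1]`. [folklore] -/
theorem ptuPhiTilde_mem (a : ℝ) (m p : ℕ) (v : Fin 4 → ℤ) (z : Fin p → Fin 4 → ℤ)
    (y : Fin p → EuclideanSpace ℝ (Fin 4)) : 0 ≤ ptuPhiTilde a m p v z y ∧ ptuPhiTilde a m p v z y ≤ 1 := by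
  unfold ptuPhiTilde ptuChiTildeFun
  exact ⟨Finset.prod_nonneg fun i _ => (ptuCut_mem _ _ _ _ _ _ _).1,
    Finset.prod_le_one (fun i _ => (ptuCut_mem _ _ _ _ _ _ _).1) fun i _ => (ptuCut_mem _ _ _ _ _ _ _).2⟩

/-- The NEAR weight takes values in `[0, 1]`. [folklore] -/
theorem ptuNear_mem (a : ℝ) (p : ℕ) (y : Fin p → EuclideanSpace ℝ (Fin 4)) :
    0 ≤ ptuNear a p y ∧ ptuNear a p y ≤ 1 := by
  unfold ptuNear
  have hin : ∀ ij : Fin p × Fin p, 0 ≤ (1 - ∏ μ : Fin 4, ptuPlateau (-((ptuR p : ℝ) * a)) ((ptuR p : ℝ) * a)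
      ((ptuR p : ℝ) * a / 4) ((y ij.1 - y ij.2) μ)) ∧ (1 - ∏ μ : Fin 4, ptuPlateau (-((ptuR p : ℝ) * a))
      ((ptuR p : ℝ) * a) ((ptuR p : ℝ) * a / 4) ((y ij.1 - y ij.2) μ)) ≤ 1 := fun ij => by
    have h0 : 0 ≤ ∏ μ : Fin 4, ptuPlateau (-((ptuR p : ℝ) * a)) ((ptuR p : ℝ) * a) ((ptuR p : ℝ) * a / 4)
        ((y ij.1 - y ij.2) μ) := Finset.prod_nonneg fun μ _ => (ptuPlateau_mem _ _ _ _).1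
    have h1 : ∏ μ : Fin 4, ptuPlateau (-((ptuR p : ℝ) * a)) ((ptuR p : ℝ) * a) ((ptuR p : ℝ) * a / 4)
        ((y ij.1 - y ij.2) μ) ≤ 1 :=
      Finset.prod_le_one (fun μ _ => (ptuPlateau_mem _ _ _ _).1) fun μ _ => (ptuPlateau_mem _ _ _ _).2
    constructor <;> linarith
  have h0 := Finset.prod_nonneg fun ij (_ : ij ∈ (Finset.univ : Finset (Fin p × Fin p)).filter
    (fun ij => ij.1 < ij.2)) => (hin ij).1
  have h1 := Finset.prod_le_one (fun ij (_ : ij ∈ (Finset.univ : Finset (Fin p × Fin p)).filter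
    (fun ij => ij.1 < ij.2)) => (hin ij).1) fun ij _ => (hin ij).2
  constructor <;> linarith

/-- The OUTER weight takes values in `[0, 1]`. [folklore] -/
theorem ptuOut_mem (a : ℝ) (L p : ℕ) (y : Fin p → EuclideanSpace ℝ (Fin 4)) :
    0 ≤ ptuOut a L p y ∧ ptuOut a L p y ≤ 1 := by
  unfold ptuOut
  have hin : ∀ i : Fin p, 0 ≤ ∏ μ : Fin 4, ptuPlateau (-(a * (L : ℝ) / 4)) (a * (L : ℝ) / 4) (a * (L : ℝ) / 8) (y i μ) ∧
      ∏ μ : Fin 4, ptuPlateau (-(a * (L : ℝ) / 4)) (a * (L : ℝ) / 4) (a * (L : ℝ) / 8) (y i μ) ≤ 1 := fun i =>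
    ⟨Finset.prod_nonneg fun μ _ => (ptuPlateau_mem _ _ _ _).1,
      Finset.prod_le_one (fun μ _ => (ptuPlateau_mem _ _ _ _).1) fun μ _ => (ptuPlateau_mem _ _ _ _).2⟩
  have h0 := Finset.prod_nonneg fun i (_ : i ∈ (Finset.univ : Finset (Fin p))) => (hin i).1
  have h1 := Finset.prod_le_one (fun i (_ : i ∈ (Finset.univ : Finset (Fin p))) => (hin i).1) fun i _ => (hin i).2
  constructor <;> linarith

/-- **Near criterion.** Where the NEAR weight is non-zero, some pair is sup-closer than `R a` (strictly). [folklore] -/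
theorem ptuNear_ne_zero_imp {a : ℝ} (ha : 0 < a) {p : ℕ} {y : Fin p → EuclideanSpace ℝ (Fin 4)}
    (h : ptuNear a p y ≠ 0) : ∃ i j : Fin p, i ≠ j ∧ ∀ μ : Fin 4, |y i μ - y j μ| < (ptuR p : ℝ) * a := by
  have hR : 0 < (ptuR p : ℝ) * a := by unfold ptuR; positivity
  by_contra hc
  push Not at hc
  apply h
  unfold ptuNear
  rw [Finset.prod_eq_one, sub_self]
  intro ij hij
  rw [Finset.mem_filter] at hij
  obtain ⟨μ, hμ⟩ := hc ij.1 ij.2 (ne_of_lt hij.2)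
  rw [Finset.prod_eq_zero (Finset.mem_univ μ), sub_zero]
  rw [PiLp.sub_apply]
  refine ptuPlateau_eq_zero (by positivity) ?_
  rcases le_abs.1 hμ with h' | h'
  · exact Or.inr h'
  · exact Or.inl (by linarith)

/-- **Near sufficiency.** If some pair is within `3Ra/4` in sup norm, the NEAR weight is `1`. [folklore] -/
theorem ptuNear_eq_one {a : ℝ} (ha : 0 < a) {p : ℕ} {y : Fin p → EuclideanSpace ℝ (Fin 4)} {i j : Fin p}
    (hij : i ≠ j) (h : ∀ μ : Fin 4, |y i μ - y j μ| ≤ 3 * ((ptuR p : ℝ) * a) / 4) : ptuNear a p y = 1 := by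
  have hR : 0 < (ptuR p : ℝ) * a := by unfold ptuR; positivity
  -- the ordered version of the pair
  have key : ∀ i' j' : Fin p, i' < j' → (∀ μ : Fin 4, |y i' μ - y j' μ| ≤ 3 * ((ptuR p : ℝ) * a) / 4) →
      ptuNear a p y = 1 := by
    intro i' j' hlt h'
    unfold ptuNear
    rw [Finset.prod_eq_zero (i := (i', j')) (Finset.mem_filter.2 ⟨Finset.mem_univ _, hlt⟩), sub_zero]
    rw [Finset.prod_eq_one fun μ _ => ?_, sub_self]
    rw [PiLp.sub_apply]
    have h1 := abs_le.1 (h' μ)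
    exact ptuPlateau_eq_one (by positivity) (by linarith) (by linarith)
  rcases lt_or_gt_of_ne hij with hlt | hlt
  · exact key i j hlt h
  · exact key j i hlt fun μ => by rw [abs_sub_comm]; exact h μ

/-- **Outer criterion.** Where the OUTER weight is non-zero, some coordinate exceeds `aL/8`. [folklore] -/
theorem ptuOut_ne_zero_imp {a : ℝ} (ha : 0 < a) {L p : ℕ} (hL : 1 ≤ L) {y : Fin p → EuclideanSpace ℝ (Fin 4)}
    (h : ptuOut a L p y ≠ 0) : ∃ (i : Fin p) (μ : Fin 4), a * (L : ℝ) / 8 < |y i μ| := by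
  have hL' : (1 : ℝ) ≤ L := by exact_mod_cast hL
  by_contra hc
  push Not at hc
  apply h
  unfold ptuOut
  rw [Finset.prod_eq_one, sub_self]
  intro i _
  refine Finset.prod_eq_one fun μ _ => ?_
  have h1 := abs_le.1 (hc i μ)
  exact ptuPlateau_eq_one (by positivity) (by linarith) (by linarith)

/-- **Outer sufficiency.** If some coordinate is `≥ aL/4` in absolute value, the OUTER weight is `1`. [folklore] -/
theorem ptuOut_eq_one {a : ℝ} (ha : 0 < a) {L p : ℕ} (hL : 1 ≤ L) {y : Fin p → EuclideanSpace ℝ (Fin 4)} {i : Fin p}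
    {μ : Fin 4} (h : a * (L : ℝ) / 4 ≤ |y i μ|) : ptuOut a L p y = 1 := by
  have hL' : (1 : ℝ) ≤ L := by exact_mod_cast hL
  have h0 : ptuPlateau (-(a * (L : ℝ) / 4)) (a * (L : ℝ) / 4) (a * (L : ℝ) / 8) (y i μ) = 0 := by
    refine ptuPlateau_eq_zero (by positivity) ?_
    rcases le_abs.1 h with h' | h'
    · exact Or.inr h'
    · exact Or.inl (by linarith)
  unfold ptuOut
  rw [Finset.prod_eq_zero (Finset.mem_univ i) (Finset.prod_eq_zero (Finset.mem_univ μ) h0), sub_zero]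

/-! ## §2 Numerics of the Whitney levels -/

/-- `64(2p+1) < 3^{m₀(p)}`. [folklore] -/
theorem ptu_lt_pow_m0 (p : ℕ) : 64 * (2 * p + 1) < 3 ^ ptuM0 p :=
  Nat.lt_pow_succ_log_self (by norm_num) _

/-- `d(m,p) ≥ 32` for `m ≥ m₀(p)`. [folklore] -/
theorem ptuD_ge {m p : ℕ} (hm : ptuM0 p ≤ m) : 32 ≤ ptuD m p := by
  unfold ptuD
  have h1 : 3 ^ ptuM0 p ≤ 3 ^ m := Nat.pow_le_pow_right (by norm_num) hm
  have h2 := ptu_lt_pow_m0 p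
  rw [Nat.le_div_iff_mul_le (by positivity)]
  calc 32 * (2 * (2 * p + 1)) = 64 * (2 * p + 1) := by ring
    _ ≤ 3 ^ m := (h2.trans_le h1).le

/-- `(2p+1) d(m,p) ≤ cellSide m` (real form of `d = ⌊3^m / (2(2p+1))⌋`). [folklore] -/
theorem ptuD_mul_le (m p : ℕ) : (2 * (p : ℝ) + 1) * (ptuD m p : ℝ) ≤ cellSide m := by
  unfold cellSide
  have h : ptuD m p * (2 * (2 * p + 1)) ≤ 3 ^ m := Nat.div_mul_le_self _ _
  have h' : ((ptuD m p * (2 * (2 * p + 1)) : ℕ) : ℝ) ≤ ((3 ^ m : ℕ) : ℝ) := by exact_mod_cast h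
  push_cast at h'
  linarith

/-- `d(m,p) ≤ cellSide m`. [folklore] -/
theorem ptuD_le_cellSide (m p : ℕ) : (ptuD m p : ℝ) ≤ cellSide m := by
  have h := ptuD_mul_le m p
  have h0 : (0 : ℝ) ≤ ptuD m p := Nat.cast_nonneg _
  have hp : (0 : ℝ) ≤ p := Nat.cast_nonneg _
  nlinarith

/-- The offsets are non-negative and at least one step `d` below the cell side. [folklore] -/
theorem ptuOffsets_spec {m p : ℕ} {v : Fin 4 → ℤ} (hv : v ∈ ptuOffsets m p) (μ : Fin 4) :
    (0 : ℝ) ≤ v μ ∧ (v μ : ℝ) + ptuD m p ≤ cellSide m := by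
  unfold ptuOffsets at hv
  rw [Finset.mem_image] at hv
  obtain ⟨j, -, rfl⟩ := hv
  have hj : ((j μ : ℕ) : ℝ) ≤ 2 * p := by
    have h1 := (j μ).isLt
    have h2 : (j μ : ℕ) ≤ 2 * p := by omega
    exact_mod_cast h2
  have hj0 : (0 : ℝ) ≤ ((j μ : ℕ) : ℝ) := Nat.cast_nonneg _
  have hd : (0 : ℝ) ≤ ptuD m p := Nat.cast_nonneg _
  have hle := ptuD_mul_le m p
  show (0 : ℝ) ≤ ((((j μ : ℕ) : ℤ) * (ptuD m p : ℤ) : ℤ) : ℝ) ∧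
    ((((j μ : ℕ) : ℤ) * (ptuD m p : ℤ) : ℤ) : ℝ) + ptuD m p ≤ cellSide m
  push_cast
  constructor
  · positivity
  · nlinarith

/-- The Whitney levels of a triadic `L` are admissible, `≥ m₀`, with `d ≥ 32`. [folklore] -/
theorem ptuLevels_spec {L p m : ℕ} (hL : IsTriadic L) (hm : m ∈ ptuLevels L p) :
    LevelAdmissible L m ∧ ptuM0 p ≤ m ∧ 32 ≤ ptuD m p := by
  unfold ptuLevels at hm
  rw [Finset.mem_filter, Finset.mem_range] at hm
  refine ⟨?_, hm.2, ptuD_ge hm.2⟩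
  obtain ⟨M, hM⟩ := hL
  unfold LevelAdmissible
  rw [hM] at hm ⊢
  rw [Nat.log_pow (by norm_num)] at hm
  exact pow_dvd_pow 3 hm.1

/-! ## §3 The index set -/

/-- Unpacking membership in the index set. [folklore] -/
theorem mem_ptuIdx {L m p : ℕ} {vz : (Fin 4 → ℤ) × (Fin p → Fin 4 → ℤ)} (h : vz ∈ ptuIdx L m p) :
    vz.1 ∈ ptuOffsets m p ∧ (∀ i, vz.2 i ∈ ptuCellBox L) ∧ (∀ i, CellInHalfBox L m vz.1 (vz.2 i)) ∧
      (∀ i j : Fin p, i ≠ j → (16 : ℝ) ≤ ‖vz.2 i - vz.2 j‖) ∧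
      ∃ i j : Fin p, i ≠ j ∧ ‖vz.2 i - vz.2 j‖ ≤ (56 : ℝ) := by
  unfold ptuIdx at h
  rw [Finset.mem_filter, Finset.mem_product, Fintype.mem_piFinset] at h
  exact ⟨h.1.1, h.1.2, h.2.1, h.2.2.1, h.2.2.2⟩

/-- Membership in the index set from its defining conditions. [folklore] -/
theorem mem_ptuIdx_of {L m p : ℕ} {v : Fin 4 → ℤ} {z : Fin p → Fin 4 → ℤ} (hv : v ∈ ptuOffsets m p)
    (hz : ∀ i, z i ∈ ptuCellBox L) (hh : ∀ i, CellInHalfBox L m v (z i))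
    (hsep : ∀ i j : Fin p, i ≠ j → (16 : ℝ) ≤ ‖z i - z j‖)
    (hcl : ∃ i j : Fin p, i ≠ j ∧ ‖z i - z j‖ ≤ (56 : ℝ)) : (v, z) ∈ ptuIdx L m p := by
  unfold ptuIdx
  rw [Finset.mem_filter, Finset.mem_product, Fintype.mem_piFinset]
  exact ⟨⟨hv, hz⟩, hh, hsep, hcl⟩

/-- The cell assignment of an index is injective (pairs are `≥ 16` apart). [folklore] -/
theorem ptuIdx_injective {L m p : ℕ} {vz : (Fin 4 → ℤ) × (Fin p → Fin 4 → ℤ)} (h : vz ∈ ptuIdx L m p) :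
    Function.Injective vz.2 := by
  intro i j hij
  by_contra hne
  have h16 := (mem_ptuIdx h).2.2.2.1 i j hne
  rw [hij, sub_self, norm_zero] at h16
  linarith

/-- A closed coordinate box of `ℝ⁴` is closed. [folklore] -/
theorem ptu_isClosed_box (lo hi : Fin 4 → ℝ) :
    IsClosed {u : EuclideanSpace ℝ (Fin 4) | ∀ μ, lo μ ≤ u μ ∧ u μ ≤ hi μ} := by
  rw [Set.setOf_forall]
  exact isClosed_iInter fun μ => by
    have hc : Continuous fun u : EuclideanSpace ℝ (Fin 4) => u μ := by fun_prop
    exact (isClosed_le continuous_const hc).inter (isClosed_le hc continuous_const)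

/-- Support of the inner cut-off: the closed box at depth `2 + d/8` inside the cell. [folklore] -/
theorem ptuChiFun_tsupport_subset {a : ℝ} (ha : 0 < a) {m p : ℕ} (hm : ptuM0 p ≤ m) (v z : Fin 4 → ℤ) :
    tsupport (ptuChiFun a m p v z) ⊆ {u : EuclideanSpace ℝ (Fin 4) | ∀ μ,
      a * ((v μ : ℝ) + cellSide m * (z μ : ℝ) + (2 + (ptuD m p : ℝ) / 8)) ≤ u μ ∧
        u μ ≤ a * ((v μ : ℝ) + cellSide m * ((z μ : ℝ) + 1) - (2 + (ptuD m p : ℝ) / 8))} := by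
  have hd32 : (32 : ℝ) ≤ ptuD m p := by exact_mod_cast ptuD_ge hm
  have hdS := ptuD_le_cellSide m p
  refine closure_minimal (fun u hu μ => ?_) (ptu_isClosed_box _ _)
  have hu' : ptuChiFun a m p v z u ≠ 0 := hu
  have h := ptuCut_mem_uIcc hu' μ
  rw [Set.uIcc_of_le] at h
  · exact h
  · nlinarith [mul_nonneg ha.le (show (0 : ℝ) ≤ cellSide m - 4 - (ptuD m p : ℝ) / 4 by linarith)]

/-- The inner cut-off is supported in the core of its cell. [folklore] -/
theorem ptuChiFun_tsupport_subset_physCore {a : ℝ} (ha : 0 < a) {m p : ℕ} (hm : ptuM0 p ≤ m)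
    (v z : Fin 4 → ℤ) : tsupport (ptuChiFun a m p v z) ⊆ physCore a m v z := by
  intro u hu μ
  have h := ptuChiFun_tsupport_subset ha hm v z hu μ
  have hd : (0 : ℝ) ≤ a * (ptuD m p : ℝ) := mul_nonneg ha.le (Nat.cast_nonneg _)
  constructor <;> nlinarith [h.1, h.2]

/-- The outer cut-off equals `1` on the support of the inner one. [folklore] -/
theorem ptuChiTildeFun_eq_one {a : ℝ} (ha : 0 < a) {m p : ℕ} (hm : ptuM0 p ≤ m) (v z : Fin 4 → ℤ)
    {u : EuclideanSpace ℝ (Fin 4)} (hu : u ∈ tsupport (ptuChiFun a m p v z)) :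
    ptuChiTildeFun a m p v z u = 1 := by
  have h := ptuChiFun_tsupport_subset ha hm v z hu
  have hd32 : (32 : ℝ) ≤ ptuD m p := by exact_mod_cast ptuD_ge hm
  unfold ptuChiTildeFun ptuCut
  refine Finset.prod_eq_one fun μ _ => ?_
  have h1 := (h μ).1
  have h2 := (h μ).2
  exact ptuPlateau_eq_one (by positivity) (by linarith) (by linarith)

/-- Support of the enlarged tensor bump: every point lies `2a` inside its cell box. [folklore] -/
theorem ptuPhiTilde_tsupport_subset {a : ℝ} (ha : 0 < a) {m p : ℕ} (hm : ptuM0 p ≤ m) (v : Fin 4 → ℤ)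
    (z : Fin p → Fin 4 → ℤ) :
    tsupport (ptuPhiTilde a m p v z) ⊆ {y : Fin p → EuclideanSpace ℝ (Fin 4) | ∀ i μ,
      a * ((v μ : ℝ) + cellSide m * (z i μ : ℝ) + 2) ≤ y i μ ∧
        y i μ ≤ a * ((v μ : ℝ) + cellSide m * ((z i μ : ℝ) + 1) - 2)} := by
  have hd32 : (32 : ℝ) ≤ ptuD m p := by exact_mod_cast ptuD_ge hm
  have hdS := ptuD_le_cellSide m p
  refine closure_minimal (fun y hy i μ => ?_) ?_
  · have hy' : ptuPhiTilde a m p v z y ≠ 0 := hy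
    unfold ptuPhiTilde at hy'
    have hi : ptuChiTildeFun a m p v (z i) (y i) ≠ 0 := (Finset.prod_ne_zero_iff.1 hy') i (Finset.mem_univ i)
    have h := ptuCut_mem_uIcc hi μ
    rw [Set.uIcc_of_le] at h
    · exact h
    · nlinarith [mul_nonneg ha.le (show (0 : ℝ) ≤ cellSide m - 4 by linarith)]
  · rw [Set.setOf_forall]
    refine isClosed_iInter fun i => ?_
    have hc : ∀ μ : Fin 4, Continuous fun y : Fin p → EuclideanSpace ℝ (Fin 4) => y i μ := fun μ => by fun_prop
    have : {y : Fin p → EuclideanSpace ℝ (Fin 4) | ∀ μ, a * ((v μ : ℝ) + cellSide m * (z i μ : ℝ) + 2) ≤ y i μ ∧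
        y i μ ≤ a * ((v μ : ℝ) + cellSide m * ((z i μ : ℝ) + 1) - 2)} =
        ⋂ μ, {y | a * ((v μ : ℝ) + cellSide m * (z i μ : ℝ) + 2) ≤ y i μ ∧
          y i μ ≤ a * ((v μ : ℝ) + cellSide m * ((z i μ : ℝ) + 1) - 2)} := Set.setOf_forall _
    rw [this]
    exact isClosed_iInter fun μ =>
      (isClosed_le continuous_const (hc μ)).inter (isClosed_le (hc μ) continuous_const)

/-- On the support of `φ̃` of an index: some pair is `≤ 240 ℓ`-close (Euclidean norm) and every point lies in
its cell box. [folklore] -/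
theorem ptuPhiTilde_tsupport_facts {a : ℝ} (ha : 0 < a) {L m p : ℕ} (hm : ptuM0 p ≤ m)
    {vz : (Fin 4 → ℤ) × (Fin p → Fin 4 → ℤ)} (hvz : vz ∈ ptuIdx L m p) {y : Fin p → EuclideanSpace ℝ (Fin 4)}
    (hy : y ∈ tsupport (ptuPhiTilde a m p vz.1 vz.2)) :
    (∃ i j : Fin p, i ≠ j ∧ ‖y i - y j‖ ≤ 240 * (a * cellSide m)) ∧
      ∀ (i : Fin p) (μ : Fin 4), a * ((vz.1 μ : ℝ) + cellSide m * (vz.2 i μ : ℝ)) ≤ y i μ ∧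
        y i μ ≤ a * ((vz.1 μ : ℝ) + cellSide m * ((vz.2 i μ : ℝ) + 1)) := by
  have h := ptuPhiTilde_tsupport_subset ha hm vz.1 vz.2 hy
  have hS : 0 < cellSide m := by unfold cellSide; positivity
  have haS : 0 < a * cellSide m := mul_pos ha hS
  refine ⟨?_, fun i μ => ⟨by nlinarith [(h i μ).1], by nlinarith [(h i μ).2]⟩⟩
  obtain ⟨i, j, hij, h56⟩ := (mem_ptuIdx hvz).2.2.2.2
  refine ⟨i, j, hij, ?_⟩
  have hcoord : ∀ μ : Fin 4, |(y i - y j) μ| ≤ 57 * (a * cellSide m) := fun μ => by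
    rw [PiLp.sub_apply]
    have hz : |((vz.2 i μ : ℝ) - vz.2 j μ)| ≤ 56 := by
      have h1 : ‖(vz.2 i - vz.2 j) μ‖ ≤ ‖vz.2 i - vz.2 j‖ := norm_le_pi_norm _ μ
      rw [Pi.sub_apply, Int.norm_eq_abs] at h1
      push_cast at h1
      linarith
    obtain ⟨hz1, hz2⟩ := abs_le.1 hz
    obtain ⟨hi1, hi2⟩ := h i μ
    obtain ⟨hj1, hj2⟩ := h j μ
    have k1 : a * cellSide m * ((vz.2 i μ : ℝ) - vz.2 j μ) ≤ a * cellSide m * 56 :=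
      mul_le_mul_of_nonneg_left hz2 haS.le
    have k2 : a * cellSide m * (-56) ≤ a * cellSide m * ((vz.2 i μ : ℝ) - vz.2 j μ) :=
      mul_le_mul_of_nonneg_left hz1 haS.le
    rw [abs_le]
    constructor <;> nlinarith
  rw [EuclideanSpace.norm_eq, Real.sqrt_le_left (by positivity)]
  calc ∑ μ, ‖(y i - y j) μ‖ ^ 2 ≤ ∑ _μ : Fin 4, (57 * (a * cellSide m)) ^ 2 :=
        Finset.sum_le_sum fun μ _ => by
          rw [Real.norm_eq_abs]
          exact pow_le_pow_left₀ (abs_nonneg _) (hcoord μ) 2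
    _ = 4 * (57 * (a * cellSide m)) ^ 2 := by
        rw [Finset.sum_const, Finset.card_univ, Fintype.card_fin, nsmul_eq_mul]
        norm_num
    _ ≤ (240 * (a * cellSide m)) ^ 2 := by nlinarith [sq_nonneg (a * cellSide m)]

/-- **Index-set facts** (registered anchor of this file): for triadic `L`, every Whitney level is admissible,
`≥ m₀`, with `d ≥ 32`, and every index has half-box cells, an injective assignment, inner cut-offs supported in the
cores, outer cut-offs `= 1` on the inner supports, and on `supp φ̃` a `≤ 240 ℓ`-close pair and the cell boxes.
[folklore] -/
theorem ptuGeom_index_facts : ∀ (a : ℝ) (L p : ℕ), 0 < a → IsTriadic L →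
    ∀ m ∈ ptuLevels L p, LevelAdmissible L m ∧ ptuM0 p ≤ m ∧ 32 ≤ ptuD m p ∧
      ∀ vz ∈ ptuIdx L m p,
        (∀ i : Fin p, CellInHalfBox L m vz.1 (vz.2 i)) ∧ Function.Injective vz.2 ∧
        (∀ i : Fin p, tsupport (ptuChiFun a m p vz.1 (vz.2 i)) ⊆ physCore a m vz.1 (vz.2 i)) ∧
        (∀ (i : Fin p) (u : EuclideanSpace ℝ (Fin 4)), u ∈ tsupport (ptuChiFun a m p vz.1 (vz.2 i)) →
          ptuChiTildeFun a m p vz.1 (vz.2 i) u = 1) ∧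
        (∀ y : (Fin p → EuclideanSpace ℝ (Fin 4)), y ∈ tsupport (ptuPhiTilde a m p vz.1 vz.2) →
          (∃ i j : Fin p, i ≠ j ∧ ‖y i - y j‖ ≤ 240 * (a * cellSide m)) ∧
          ∀ (i : Fin p) (μ : Fin 4), a * ((vz.1 μ : ℝ) + cellSide m * (vz.2 i μ : ℝ)) ≤ y i μ ∧
            y i μ ≤ a * ((vz.1 μ : ℝ) + cellSide m * ((vz.2 i μ : ℝ) + 1))) := by
  intro a L p ha hL m hm
  obtain ⟨hadm, hm0, hd⟩ := ptuLevels_spec hL hm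
  refine ⟨hadm, hm0, hd, fun vz hvz => ⟨(mem_ptuIdx hvz).2.2.1, ptuIdx_injective hvz,
    fun i => ptuChiFun_tsupport_subset_physCore ha hm0 vz.1 (vz.2 i),
    fun i u hu => ptuChiTildeFun_eq_one ha hm0 vz.1 (vz.2 i) hu,
    fun y hy => ptuPhiTilde_tsupport_facts ha hm0 hvz hy⟩⟩

end Summit.QuantumFields.YangMills.Theorems.ContinuumLegGivenGap

end
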